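import Mathlib
import HarnessLib
import Summits.ValiantsHypothesis.ValiantsHypothesis.Theorems.MonotoneRestorationOrbitRestorationQPSharpResidueAffineSubst
import Summits.ValiantsHypothesis.ValiantsHypothesis.Theorems.MonotoneRestorationMonotoneRestorationQPSparseRegime
import Literature.Computability.AlgebraicComplexity.SymmetricOrbitCircuitEval

/-!
# The quasi-polynomially SPARSE and the POLYLOG-DEGREE strata per level, and the sharpened wild residue of A_∞ with NINE
# exclusions (crux `OrbitRestorationQP`, stmt-ValiantsHypothesis-18293 — line `depth-three-rung`, registered stub
# `stub_sigmaPiSigmaValue` = A_∞)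

Namespace `Summit.ValiantsHypothesis.ValiantsHypothesis.Theorems.SmlAffineRestoration`.  Definition-free.

The FLOOR of the product-depth ladder (sparse / polylog-degree families) is in the tree in SIZE currency for the crux
(`SparseRegime`, `…MonotoneRestorationQPSparseRegime.lean`: the orbit circuit of an invariant polynomial has
`≤ n² + |supp|·n²·deg + 2|supp| + 1` gates, `OrbitCircuit.exists_symmetric_circuit_of_invariant`).  Orbit size is at most size, so
the floor holds in ORBIT currency per level with one constant per exponent; we record it and remove it from the residue of A_∞:

* `qpOrbitRestorable_of_qpSparse` — `∀ c ∃ c' ∀ n p`: a diagonally invariant `p` with `≤ 2^((log₂ n + c)^c)` monomials and total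
  degree `≤ 2^((log₂ n + c)^c)` is `QPOrbitRestorable c' n p`;
* `qpOrbitRestorable_of_polylogDegree` — `∀ c ∃ c' ∀ n p`: a diagonally invariant `p` of total degree `≤ (log₂ n + c)^c` is
  `QPOrbitRestorable c' n p` (it has `≤ (n² + 1)^deg` monomials);
* `sigmaPiSigmaValue_of_sharpResidue₉` — **A_∞ follows from restoring, with one constant per exponent `c`, the matrix-symmetric
  `p ∈ PDClass (fun _ => 1) n c` with the seven exclusion pairs of `sigmaPiSigmaValue_of_sharpResidue₇` AND (x) `p` has MORE than
  `2^((log₂ n + c)^c)` monomials AND (xi) total degree `> (log₂ n + c)^c`.**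

So a counterexample to the stub — equivalently the content of its residue — lives in degree `(log n)^{ω(1)}` with
super-quasi-polynomially many monomials, outside `ℂ[r,c]`, outside both wreath strata, outside the affine set-multilinear strata
and their images under equivariant affine changes of variables, with large graded catalecticant rank, and without groupable
depth-three representation.  Honest label: bookkeeping (census in kernel form); no stub closed; VP ≠ VNP untouched. [folklore]
-/

noncomputable section

open scoped Classical

-- `Summit.ValiantsHypothesis.ValiantsHypothesis.…` is the tree's single-conjunct layout (Sub = Summit).
set_option linter.dupNamespace false

namespace Summit.ValiantsHypothesis.ValiantsHypothesis.Theorems.SmlAffineRestoration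

open MvPolynomial Finset Equiv Literature.Computability.AlgebraicComplexity OrbitRestorationQPDepthThreeRung DerivativeTower
  AffineSubst Summit.ValiantsHypothesis.ValiantsHypothesis.Theorems

/-! ### The floor per level -/

/-- **QUASI-POLYNOMIALLY SPARSE ⇒ RESTORABLE, per level, one constant per exponent.**  A diagonally invariant polynomial with
`≤ 2^((log₂ n + c)^c)` monomials and total degree `≤ 2^((log₂ n + c)^c)` is `QPOrbitRestorable c' n p` (the orbit circuit of its
monomials; orbit size `≤` size). [folklore] -/
theorem qpOrbitRestorable_of_qpSparse (c : ℕ) : ∃ c' : ℕ, ∀ (n : ℕ) (p : MvPolynomial (Fin n × Fin n) ℂ),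
    (∀ σ : Perm (Fin n), rename (fun pq : Fin n × Fin n => σ • pq) p = p) →
    p.support.card ≤ 2 ^ ((Nat.log 2 n + c) ^ c) → p.totalDegree ≤ 2 ^ ((Nat.log 2 n + c) ^ c) →
    QPOrbitRestorable c' n p := by
  obtain ⟨c', hc'⟩ := SparseRegime.qpSparse_size_le c
  refine ⟨c', fun n p hinv hS hD => ?_⟩
  obtain ⟨G, inst, C, hC, hev, hcard⟩ := OrbitCircuit.exists_symmetric_circuit_of_invariant p hinv
  exact ⟨G, inst, C, hC, hev, ((C.orbitSize_le_size _).trans hcard).trans (hc' n _ _ hS hD)⟩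

/-- **POLYLOG DEGREE ⇒ RESTORABLE, per level, one constant per exponent.**  A diagonally invariant polynomial of total degree
`≤ (log₂ n + c)^c` is `QPOrbitRestorable c' n p`. [folklore] -/
theorem qpOrbitRestorable_of_polylogDegree (c : ℕ) : ∃ c' : ℕ, ∀ (n : ℕ) (p : MvPolynomial (Fin n × Fin n) ℂ),
    (∀ σ : Perm (Fin n), rename (fun pq : Fin n × Fin n => σ • pq) p = p) →
    p.totalDegree ≤ (Nat.log 2 n + c) ^ c → QPOrbitRestorable c' n p := by
  obtain ⟨c₁, hc₁⟩ := SparseRegime.polylogDegree_sparse_le c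
  obtain ⟨c', hc'⟩ := qpOrbitRestorable_of_qpSparse c₁
  refine ⟨c', fun n p hinv hdeg => hc' n p hinv ?_ (hc₁ n _ hdeg).2⟩
  calc p.support.card ≤ (Fintype.card (Fin n × Fin n) + 1) ^ p.totalDegree :=
        OrbitCircuit.card_support_le_of_totalDegree_le p le_rfl
    _ = (n * n + 1) ^ p.totalDegree := by rw [Fintype.card_prod, Fintype.card_fin]
    _ ≤ 2 ^ ((Nat.log 2 n + c₁) ^ c₁) := (hc₁ n _ hdeg).1

/-! ### The residue with nine exclusions -/

/-- **SHARPER RESIDUE, NINE EXCLUSIONS ⇒ A_∞.**  As `sigmaPiSigmaValue_of_sharpResidue₇`, and the residue-prover may moreover assume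
that `p` has more than `2^((log₂ n + c)^c)` monomials and total degree `> (log₂ n + c)^c`.  Conclusion = the stub's signature
verbatim. [folklore] -/
theorem sigmaPiSigmaValue_of_sharpResidue₉
    (hW : ∀ c : ℕ, ∃ c' : ℕ, ∀ (n : ℕ) (p : MvPolynomial (Fin n × Fin n) ℂ),
      (∀ σ τ : Perm (Fin n), rename (fun q : Fin n × Fin n => (σ q.1, τ q.2)) p = p) →
      PDClass (fun _ => 1) n c p → ¬ GroupableUpTo 0 n c p →
      (∃ a a' b b' : Fin n, pderiv (a, b) p - pderiv (a', b) p - pderiv (a, b') p + pderiv (a', b') p ≠ 0) →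
      (∃ (i : Fin n) (τ : Perm (Fin n)),
        rename (fun q : Fin n × Fin n => if q.1 = i then (q.1, τ q.2) else q) p ≠ p) →
      (∃ (j : Fin n) (τ : Perm (Fin n)),
        rename (fun q : Fin n × Fin n => if q.2 = j then (τ q.1, q.2) else q) p ≠ p) →
      (¬ ∃ (s : ℕ) (β : Fin s → Fin n → ℂ) (α : Fin s → Fin n → Fin n → ℂ), s ≤ n ^ c + c ∧
        p = ∑ t : Fin s, ∏ b : Fin n, (C (β t b) + ∑ a : Fin n, C (α t b a) * X (a, b))) →
      (¬ ∃ (s : ℕ) (β : Fin s → Fin n → ℂ) (α : Fin s → Fin n → Fin n → ℂ), s ≤ n ^ c + c ∧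
        p = ∑ t : Fin s, ∏ a : Fin n, (C (β t a) + ∑ b : Fin n, C (α t a b) * X (a, b))) →
      (∃ e m : ℕ, FiniteDimensional ℂ (derivChain (homogeneousComponent e p) m) →
        n ^ c + c < Module.finrank ℂ (derivChain (homogeneousComponent e p) m)) →
      (¬ ∃ (α β γ δ ε : ℂ) (q : MvPolynomial (Fin n × Fin n) ℂ),
        (∀ σ τ : Perm (Fin n), rename (fun x : Fin n × Fin n => (σ x.1, τ x.2)) q = q) ∧
        (∃ (s : ℕ) (β' : Fin s → Fin n → ℂ) (α' : Fin s → Fin n → Fin n → ℂ), s ≤ n ^ c + c ∧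
          q = ∑ t : Fin s, ∏ b : Fin n, (C (β' t b) + ∑ a : Fin n, C (α' t b a) * X (a, b))) ∧
        p = aeval (fun x : Fin n × Fin n => C α * X x + C β * ∑ b : Fin n, X (x.1, b) + C γ * ∑ a : Fin n, X (a, x.2) +
          C δ * ∑ a : Fin n, ∑ b : Fin n, X (a, b) + C ε : Fin n × Fin n → MvPolynomial (Fin n × Fin n) ℂ) q) →
      (¬ ∃ (α β γ δ ε : ℂ) (q : MvPolynomial (Fin n × Fin n) ℂ),
        (∀ σ τ : Perm (Fin n), rename (fun x : Fin n × Fin n => (σ x.1, τ x.2)) q = q) ∧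
        (∃ (s : ℕ) (β' : Fin s → Fin n → ℂ) (α' : Fin s → Fin n → Fin n → ℂ), s ≤ n ^ c + c ∧
          q = ∑ t : Fin s, ∏ a : Fin n, (C (β' t a) + ∑ b : Fin n, C (α' t a b) * X (a, b))) ∧
        p = aeval (fun x : Fin n × Fin n => C α * X x + C β * ∑ b : Fin n, X (x.1, b) + C γ * ∑ a : Fin n, X (a, x.2) +
          C δ * ∑ a : Fin n, ∑ b : Fin n, X (a, b) + C ε : Fin n × Fin n → MvPolynomial (Fin n × Fin n) ℂ) q) →
      2 ^ ((Nat.log 2 n + c) ^ c) < p.support.card → (Nat.log 2 n + c) ^ c < p.totalDegree →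
      QPOrbitRestorable c' n p) :
    ∀ f : (n : ℕ) → MvPolynomial (Fin n × Fin n) ℂ, IsMatrixSymmetric f →
      (∃ c : ℕ, ∀ n : ℕ, PDClass (fun _ => 1) n c (f n)) →
      ∃ c : ℕ, ∀ n : ℕ, QPOrbitRestorable c n (f n) := by
  refine sigmaPiSigmaValue_of_sharpResidue₇ fun c => ?_
  obtain ⟨c', hc'⟩ := hW c
  -- one exponent `c₃ ≥ c` whose quasi-polynomial bound dominates the degree bound `n^c + c` of the slice
  obtain ⟨c₃, hc₃⟩ := zeta_poly_mul_qp_le 2 c c 1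
  obtain ⟨c₁, hc₁⟩ := qpOrbitRestorable_of_qpSparse c₃
  obtain ⟨c₂, hc₂⟩ := qpOrbitRestorable_of_polylogDegree c
  refine ⟨max c' (max c₁ c₂), fun n p hsym hPD hng hD hrow hcol hC hR hcat hφC hφR => ?_⟩
  have hinv : ∀ σ : Perm (Fin n), rename (fun pq : Fin n × Fin n => σ • pq) p = p := fun σ => hsym σ σ
  have hqp : 2 ^ ((Nat.log 2 n + c) ^ c) ≤ 2 ^ ((Nat.log 2 n + c₃) ^ c₃) := by
    have h1 : 0 < 2 * (n + 2) ^ c := Nat.mul_pos (by norm_num) (Nat.pow_pos (by omega))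
    calc 2 ^ ((Nat.log 2 n + c) ^ c) = 2 ^ (1 * (Nat.log 2 n + c) ^ c) := by rw [one_mul]
      _ ≤ 2 * (n + 2) ^ c * 2 ^ (1 * (Nat.log 2 n + c) ^ c) := Nat.le_mul_of_pos_left _ h1
      _ ≤ 2 ^ ((Nat.log 2 n + c₃) ^ c₃) := hc₃ n
  have hdeg₃ : p.totalDegree ≤ 2 ^ ((Nat.log 2 n + c₃) ^ c₃) := by
    have h1 : p.totalDegree ≤ 2 * (n + 2) ^ c :=
      Literature.Computability.AlgebraicComplexity.DepthReduction.le_two_mul_pow hPD.1 le_rfl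
    have h2 : 2 * (n + 2) ^ c ≤ 2 * (n + 2) ^ c * 2 ^ (1 * (Nat.log 2 n + c) ^ c) :=
      Nat.le_mul_of_pos_right _ Nat.one_le_two_pow
    exact h1.trans (h2.trans (hc₃ n))
  by_cases hdeg : p.totalDegree ≤ (Nat.log 2 n + c) ^ c
  · exact Restorable.qpOrbitRestorable_mono (le_max_of_le_right (le_max_right _ _)) (hc₂ n p hinv hdeg)
  by_cases hsp : p.support.card ≤ 2 ^ ((Nat.log 2 n + c) ^ c)
  · exact Restorable.qpOrbitRestorable_mono (le_max_of_le_right (le_max_left _ _))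
      (hc₁ n p hinv (hsp.trans hqp) hdeg₃)
  · exact Restorable.qpOrbitRestorable_mono (le_max_left _ _)
      (hc' n p hsym hPD hng hD hrow hcol hC hR hcat hφC hφR (lt_of_not_ge hsp) (lt_of_not_ge hdeg))

end Summit.ValiantsHypothesis.ValiantsHypothesis.Theorems.SmlAffineRestoration

end
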